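import Summits.HodgeConjecture.HodgeConjecture.Theorems.BoundaryReadoutPullbackAlgebraicDeformationDatum
import Literature.AlgebraicGeometry.Resolution.GenericPointsOfClosure
import Literature.AlgebraicGeometry.HodgeTheory.GysinFormalismCorrespondences
import Literature.AlgebraicGeometry.HodgeTheory.IsoTransport
import Literature.AlgebraicGeometry.Motives.BettiCycleClassProofs
import Literature.AlgebraicGeometry.HodgeTheory.CorrespondenceSupportedVanishing
import HarnessLib

/-!
# Crux `PullbackAlgebraic` (stmt-HodgeConjecture-1071): the codimension bookkeeping of the closures
# `Z̄ = closure (β⁻¹(Z × T) ∖ E)` in the deformation space (hypothesis `hZ` of the constructed datum)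

Work item stmt-HodgeConjecture-1071. Discharge of the hypothesis `hZ` of
`constantLiftDatum_of_exceptionalDivisor` / `PullbackAlgebraic_of_exceptionalDivisor`
(`Theorems/BoundaryReadoutPullbackAlgebraicDeformationDatum`): for the blowing up `β : B → Y ⊗ T` of
`Y ⊗ T` along a closed immersion `ic : X ↪ Y ⊗ T` (an isomorphism over the complement of the centre),
its exceptional divisor `k = pr₁ : E = B ×_{Y ⊗ T} X → B` (smooth projective of dimension
`dim B - 1`), and a Zariski-closed `Z ⊆ Y` all of whose points have codimension `≥ p`:

* every point of `S = β⁻¹(pr_Y⁻¹ Z) ∖ k(E)` has codimension `≥ p` in `B` (off `k(E)` the blowing up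
  is an isomorphism onto an open of `Y ⊗ T`, and codimension does not drop along the flat `pr_Y`,
  Hartshorne III 9.5);
* hence so does every point of `closure S` (it is a specialisation of a point of `S`: the generic
  points of the components of the closure of the locally closed `S` lie in `S`,
  `exists_mem_inter_specializes_of_mem_closure`);
* and every point `e` of `E` with `k(e) ∈ closure S` has codimension `≥ p` in `E`: `k(e)` is a STRICT
  specialisation of a point of `S` (which misses `k(E)`), so has codimension `≥ p + 1` in `B`, and
  `codim_E e + 1 = codim_B k(e)` (dimension formula on `B` and `E`, closed immersions preserve the
  dimension of the closure of a point).

## References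

* [Fulton1998] W. Fulton, Intersection Theory, 2nd ed. (1998), §5.1, App. B.6.6.
* [Hartshorne1977] R. Hartshorne, Algebraic Geometry (1977), III Prop. 9.5, II Ex. 3.20.
-/

noncomputable section

-- every declaration of this problem lives in `Summit.HodgeConjecture.HodgeConjecture.…` (summit = sub-problem)
set_option linter.dupNamespace false

namespace Summit.HodgeConjecture.HodgeConjecture.Theorems

open CategoryTheory CategoryTheory.Limits AlgebraicGeometry MonoidalCategory CartesianMonoidalCategory
open Literature.AlgebraicGeometry Literature.AlgebraicGeometry.Motives Literature.AlgebraicGeometry.Resolution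
open Literature.AlgebraicGeometry.HodgeTheory

/-- **Codimension bookkeeping of the closures in the deformation space** (the hypothesis `hZ` of
`PullbackAlgebraic_of_exceptionalDivisor`, proved). [cite: Fulton1998, §5.1 and App. B.6.6]
[cite: Hartshorne1977, III Prop. 9.5 and II Ex. 3.20] -/
theorem zbar_coheight_bookkeeping :
    ∀ ⦃m r : ℕ⦄ ⦃Y X B : SchemeOver ℂ⦄ (T : SchemeOver ℂ) (ic : X ⟶ Y ⊗ T) (β : B ⟶ Y ⊗ T),
      IsSmoothProjective (m + r) Y → IsSmoothProjective 1 T → IsSmoothProjective m X →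
      IsClosedImmersion ic.left → IsBlowup β.left ic.left.ker →
      IsSmoothProjective (m + r + 1) B → IsIso (β.left ∣_ centreCompl ic.left.ker) →
      IsSmoothProjective (m + r) (Over.mk (pullback.snd β.left ic.left ≫ X.hom) : SchemeOver ℂ) →
      ∀ (p : ℕ) (Z : Set Y.left), IsClosed Z → (∀ z ∈ Z, (p : ℕ∞) ≤ Order.coheight z) →
        (∀ w ∈ closure ((β.left ≫ (fst Y T).left) ⁻¹' Z \ Set.range (pullback.fst β.left ic.left)),
          (p : ℕ∞) ≤ Order.coheight w) ∧
        ∀ w ∈ (pullback.fst β.left ic.left) ⁻¹'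
            closure ((β.left ≫ (fst Y T).left) ⁻¹' Z \ Set.range (pullback.fst β.left ic.left)),
          (p : ℕ∞) ≤ Order.coheight w := by
  intro m r Y X B T ic β hY hT _hX hic _hβ hB hiso hE p Z hZc hZp
  haveI := hic
  have hYT : IsSmoothProjective (m + r + 1) (Y ⊗ T) := IsSmoothProjective.tensor_holds hY hT
  haveI : IsLocallyNoetherian Y.left := IsSmoothProjective.isLocallyNoetherian_holds hY
  haveI : IsLocallyNoetherian (Y ⊗ T).left := IsSmoothProjective.isLocallyNoetherian_holds hYT
  haveI : Flat (fst Y T).left := by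
    change Flat (pullback.fst Y.hom T.hom)
    haveI : Subsingleton ↥(Spec (CommRingCat.of ℂ)) := inferInstanceAs (Subsingleton (PrimeSpectrum ℂ))
    exact MorphismProperty.pullback_fst _ _ inferInstance
  haveI : TopologicalSpace.NoetherianSpace ↥B.left := noetherianSpace_of_isSmoothProjective hB
  haveI : IsClosedImmersion (pullback.fst β.left ic.left) := inferInstance
  set U : (Y ⊗ T).left.Opens := centreCompl ic.left.ker with hU
  set S : Set B.left :=
    (β.left ≫ (fst Y T).left) ⁻¹' Z \ Set.range (pullback.fst β.left ic.left) with hS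
  -- (1) the points of `S` have codimension `≥ p`
  have hSp : ∀ w ∈ S, (p : ℕ∞) ≤ Order.coheight w := by
    rintro w ⟨hwZ, hwE⟩
    -- `β w` lies off the centre
    have hβw : β.left.base w ∈ U := by
      change β.left.base w ∈ ((centreCompl ic.left.ker : (Y ⊗ T).left.Opens) : Set (Y ⊗ T).left)
      rw [centreCompl_ker]
      intro hmem
      apply hwE
      rw [Scheme.Pullback.range_fst]
      exact hmem
    -- over `U` the blowing up is an isomorphism: codimension is preserved
    have hw : w ∈ β.left ⁻¹ᵁ U := hβw
    have hw' : w ∈ Set.range (β.left ⁻¹ᵁ U).ι.base := by rwa [Scheme.Opens.range_ι]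
    obtain ⟨w', rfl⟩ := hw'
    have e2 : β.left.base ((β.left ⁻¹ᵁ U).ι.base w') = U.ι.base ((β.left ∣_ U).base w') :=
      (congrArg (fun φ ↦ φ.base w') (morphismRestrict_ι β.left U)).symm
    have e3 := coheight_base_eq_of_iso (asIso (β.left ∣_ U)) w'
    rw [asIso_hom] at e3
    rw [coheight_eq_of_isOpenImmersion (β.left ⁻¹ᵁ U).ι, ← e3, ← coheight_eq_of_isOpenImmersion U.ι, ← e2]
    -- codimension does not drop along the flat `pr_Y`
    refine (hZp _ hwZ).trans ?_
    exact coheight_base_le_of_flat (fst Y T).left (β.left.base ((β.left ⁻¹ᵁ U).ι.base w'))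
  -- `S = F ∩ G` with `F` closed, `G` open
  have hF : IsClosed ((β.left ≫ (fst Y T).left) ⁻¹' Z) := hZc.preimage (β.left ≫ (fst Y T).left).continuous
  have hG : IsOpen (Set.range (pullback.fst β.left ic.left))ᶜ :=
    (pullback.fst β.left ic.left).isClosedEmbedding.isClosed_range.isOpen_compl
  have hSFG : S = (β.left ≫ (fst Y T).left) ⁻¹' Z ∩ (Set.range (pullback.fst β.left ic.left))ᶜ :=
    Set.sdiff_eq _ _
  refine ⟨fun w hw ↦ ?_, fun e he ↦ ?_⟩
  · -- (2) points of the closure are specialisations of points of `S`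
    rw [hSFG] at hw
    obtain ⟨ξ, hξ, hξw⟩ := exists_mem_inter_specializes_of_mem_closure hF hG hw
    rw [← hSFG] at hξ
    exact (hSp ξ hξ).trans (Order.coheight_anti (Scheme.le_iff_specializes.2 hξw))
  · -- (3) points of `E` over the closure: a strict specialisation, then the dimension formula
    have hw : (pullback.fst β.left ic.left).base e ∈ closure S := he
    rw [hSFG] at hw
    obtain ⟨ξ, hξ, hξw⟩ := exists_mem_inter_specializes_of_mem_closure hF hG hw
    have hne : ξ ≠ (pullback.fst β.left ic.left).base e := by
      rintro rfl
      exact hξ.2 (Set.mem_range_self e)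
    rw [← hSFG] at hξ
    have hk : ((p + 1 : ℕ) : ℕ∞) ≤ Order.coheight ((pullback.fst β.left ic.left).base e) := by
      have hlt : (pullback.fst β.left ic.left).base e < ξ := by
        refine lt_of_le_not_ge (Scheme.le_iff_specializes.2 hξw) fun h' ↦ hne ?_
        exact (hξw.antisymm (Scheme.le_iff_specializes.1 h')).eq
      calc ((p + 1 : ℕ) : ℕ∞) = (p : ℕ∞) + 1 := by push_cast; rfl
        _ ≤ Order.coheight ξ + 1 := add_le_add (hSp ξ hξ) le_rfl
        _ ≤ Order.coheight ((pullback.fst β.left ic.left).base e) := Order.coheight_add_one_le hlt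
    -- dimension formula on `B` and on `E`
    obtain ⟨a1, c1, ha1, hc1, h1⟩ := exists_height_eq_coheight_eq hB ((pullback.fst β.left ic.left).base e)
    obtain ⟨a2, c2, ha2, hc2, h2⟩ := exists_height_eq_coheight_eq hE e
    have hheq : Order.height ((pullback.fst β.left ic.left).base e) =
        @Order.height (↥(pullback β.left ic.left)) _ e :=
      Motives.Scheme.height_base_eq_of_isClosedImmersion (pullback.fst β.left ic.left) e
    have ha2' : @Order.height (↥(pullback β.left ic.left)) _ e = a2 := ha2
    have hc2' : @Order.coheight (↥(pullback β.left ic.left)) _ e = c2 := hc2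
    have e12 : a1 = a2 := by
      have h : (a1 : ℕ∞) = a2 := by rw [← ha1, ← ha2', hheq]
      exact_mod_cast h
    rw [hc1] at hk
    have hk' : p + 1 ≤ c1 := by exact_mod_cast hk
    change (p : ℕ∞) ≤ @Order.coheight (↥(pullback β.left ic.left)) _ e
    rw [hc2']
    have h : p ≤ c2 := by omega
    exact_mod_cast h



/-- **The crux modulo the exceptional-divisor structure and the section pull-back** (the bookkeeping
hypothesis `hZ` of `PullbackAlgebraic_of_exceptionalDivisor` discharged by `zbar_coheight_bookkeeping`).
[cite: Fulton1998, §5.1, §6.2 and Cor. 19.2 (b)] [cite: Hartshorne1977, II Thm. 8.24] -/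
theorem PullbackAlgebraic_of_exceptionalDivisor₂
    (hα : Hartshorne1977_exceptionalDivisor_locallyTrivial.{0})
    (hE : ∀ ⦃m r : ℕ⦄ ⦃V Z B : SchemeOver ℂ⦄ (i : Z ⟶ V) (β : B ⟶ V),
      IsSmoothProjective (m + r + 1) V → IsSmoothProjective m Z → IsClosedImmersion i.left →
      IsBlowup β.left i.left.ker →
      IsSmoothProjective (m + r) (Over.mk (pullback.snd β.left i.left ≫ Z.hom) : SchemeOver ℂ))
    (hSec : ∀ ⦃n r : ℕ⦄ ⦃X E : SchemeOver ℂ⦄ (q : E ⟶ X) (s : X ⟶ E), IsSmoothProjective n X →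
      IsSmoothProjective (n + r) E → s ≫ q = 𝟙 X →
      (∀ x : X.left, ∃ U : X.left.Opens, x ∈ U ∧
        ∃ ψ : (Over.mk ((q.left ⁻¹ᵁ U).ι ≫ E.hom) : SchemeOver ℂ) ≅
            (Over.mk (U.ι ≫ X.hom) : SchemeOver ℂ) ⊗ Motives.projectiveSpace r ℂ,
          ψ.hom.left ≫ (fst (Over.mk (U.ι ≫ X.hom) : SchemeOver ℂ)
            (Motives.projectiveSpace r ℂ)).left ≫ U.ι = (q.left ⁻¹ᵁ U).ι ≫ q.left) →
      ∀ (p : ℕ), ∀ y ∈ algebraicClasses E p,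
        complexBetti.map s (2 * p) y ∈ algebraicClasses X p) :
    Summit.HodgeConjecture.HodgeConjecture.Theses.QbarEnvelope.PullbackAlgebraic :=
  PullbackAlgebraic_of_exceptionalDivisor hα hE zbar_coheight_bookkeeping hSec

/-- The same for the `BoundaryReadout` decl of the crux. [cite: Fulton1998, §19.2 Cor. 19.2 (b)] -/
theorem boundaryReadout_pullbackAlgebraic_of_exceptionalDivisor₂
    (hα : Hartshorne1977_exceptionalDivisor_locallyTrivial.{0})
    (hE : ∀ ⦃m r : ℕ⦄ ⦃V Z B : SchemeOver ℂ⦄ (i : Z ⟶ V) (β : B ⟶ V),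
      IsSmoothProjective (m + r + 1) V → IsSmoothProjective m Z → IsClosedImmersion i.left →
      IsBlowup β.left i.left.ker →
      IsSmoothProjective (m + r) (Over.mk (pullback.snd β.left i.left ≫ Z.hom) : SchemeOver ℂ))
    (hSec : ∀ ⦃n r : ℕ⦄ ⦃X E : SchemeOver ℂ⦄ (q : E ⟶ X) (s : X ⟶ E), IsSmoothProjective n X →
      IsSmoothProjective (n + r) E → s ≫ q = 𝟙 X →
      (∀ x : X.left, ∃ U : X.left.Opens, x ∈ U ∧
        ∃ ψ : (Over.mk ((q.left ⁻¹ᵁ U).ι ≫ E.hom) : SchemeOver ℂ) ≅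
            (Over.mk (U.ι ≫ X.hom) : SchemeOver ℂ) ⊗ Motives.projectiveSpace r ℂ,
          ψ.hom.left ≫ (fst (Over.mk (U.ι ≫ X.hom) : SchemeOver ℂ)
            (Motives.projectiveSpace r ℂ)).left ≫ U.ι = (q.left ⁻¹ᵁ U).ι ≫ q.left) →
      ∀ (p : ℕ), ∀ y ∈ algebraicClasses E p,
        complexBetti.map s (2 * p) y ∈ algebraicClasses X p) :
    Summit.HodgeConjecture.HodgeConjecture.Theses.BoundaryReadout.PullbackAlgebraic :=
  fun _ _ hX _ _ hW ι p c' hc' ↦ PullbackAlgebraic_of_exceptionalDivisor₂ hα hE hSec hX hW ι p c' hc'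

end Summit.HodgeConjecture.HodgeConjecture.Theorems

end
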